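import Summits.ResolutionOfSingularities.ResolutionOfSingularities.Theorems.FrobeniusLadderFRationalResolutionFRationalSurfaceAnCharts
import Summits.ResolutionOfSingularities.ResolutionOfSingularities.Theorems.FrobeniusLadderFRationalResolutionStalkIsoNhd
import Summits.ResolutionOfSingularities.ResolutionOfSingularities.Theorems.FrobeniusLadderFRationalResolutionAnRegularLocus
import Summits.ResolutionOfSingularities.ResolutionOfSingularities.Theorems.FrobeniusLadderFRationalResolutionRegularLocusOpenImmersion
import Summits.ResolutionOfSingularities.ResolutionOfSingularities.Theorems.FrobeniusLadderFRationalResolutionAnResolutionBase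
import HarnessLib

/-!
# F-rational surfaces whose singular STALKS are `A_n` local rings are resolvable (intrinsic showcase)

Support file for crux stmt-ResolutionOfSingularities-15317 (`FrobeniusLadder.FRationalResolution`),
line `Sketch`, continuation seat c3, cycle 9 (theme REC). The showcase
`hasResolution_fRational_surface_of_An_charts` (p151863) assumed Zariski CHARTS (open immersions
into `A_n = Spec k[y,z,x]/(yz + x^(n+1))`) at the singular points. With Zariski-local recognition
(`exists_isOpenImmersion_nhd_of_stalk_iso`: a `k`-compatible isomorphism of stalks spreads to an
open immersion of a neighbourhood), the hypothesis becomes INTRINSIC: it suffices that the local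
ring of `X` at each singular point be `k`-isomorphic to the local ring of some `A_n` at its origin.
The regular loci correspond (`preimage_regularLocus_of_isOpenImmersion`,
`An_mem_regularLocus_iff`), the case `n = 0` is vacuous (`A_0` is regular, `An_zero_isRegular`),
and the chart showcase applies. [folklore; Kollár 2007 §2.2, Lipman 1978 §2]
-/

-- single-problem summit: the doubled namespace component is forced
set_option linter.dupNamespace false

noncomputable section

namespace Summit.ResolutionOfSingularities.ResolutionOfSingularities.Theorems.FRationalResolution

open CategoryTheory AlgebraicGeometry TopologicalSpace MvPolynomial
open Literature.AlgebraicGeometry.Resolution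

variable (k : Type) [Field k]

local notation3 "gA[" n "]" => (X (Sum.inl 0) * X (Sum.inl 1) + rename Sum.inr (X 0 ^ (n + 1)) :
  MvPolynomial (Fin 2 ⊕ Fin 1) k)
local notation3 "RA[" n "]" => MvPolynomial (Fin 2 ⊕ Fin 1) k ⧸ Ideal.span {gA[n]}
local notation3 "mkA[" n "]" => Ideal.Quotient.mk (Ideal.span {gA[n]})

/-- The structure morphism `A_n → Spec k` is locally of finite type. -/
theorem An_locallyOfFiniteType (n : ℕ) :
    LocallyOfFiniteType (Spec.map (CommRingCat.ofHom (algebraMap k RA[n]))) :=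
  (HasRingHomProperty.Spec_iff (P := @LocallyOfFiniteType)).mpr
    (RingHom.finiteType_algebraMap.mpr inferInstance)

/-- Two points of `A_n` at which all three coordinate functions vanish coincide (both are the
origin). -/
theorem An_point_eq_of_X_mem (n : ℕ) (q q' : Spec (CommRingCat.of RA[n]))
    (hq : mkA[n] (MvPolynomial.X (Sum.inl 0)) ∈ q.asIdeal ∧ mkA[n] (MvPolynomial.X (Sum.inl 1)) ∈ q.asIdeal ∧
      mkA[n] (MvPolynomial.X (Sum.inr 0)) ∈ q.asIdeal)
    (hq' : mkA[n] (MvPolynomial.X (Sum.inl 0)) ∈ q'.asIdeal ∧ mkA[n] (MvPolynomial.X (Sum.inl 1)) ∈ q'.asIdeal ∧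
      mkA[n] (MvPolynomial.X (Sum.inr 0)) ∈ q'.asIdeal) : q = q' := by
  have key : ∀ r : Spec (CommRingCat.of RA[n]),
      (mkA[n] (MvPolynomial.X (Sum.inl 0)) ∈ r.asIdeal ∧ mkA[n] (MvPolynomial.X (Sum.inl 1)) ∈ r.asIdeal ∧
        mkA[n] (MvPolynomial.X (Sum.inr 0)) ∈ r.asIdeal) →
      r.asIdeal.comap mkA[n] = Ideal.span (Set.range MvPolynomial.X) := by
    rintro r ⟨hy, hz, hx⟩
    haveI : (r.asIdeal.comap mkA[n]).IsPrime := Ideal.comap_isPrime _ _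
    exact eq_span_range_X_of_X_mem k _ hy hz hx
  apply PrimeSpectrum.ext
  have h := (key q hq).trans (key q' hq').symm
  exact Ideal.comap_injective_of_surjective _ Ideal.Quotient.mk_surjective h

/-- **F-RATIONAL SURFACES WITH `A_n` STALKS ARE RESOLVABLE.** Let `X` be an integral `k`-scheme of
finite type over a field `k` of characteristic `p`, of dimension `≤ 2`, whose stalks satisfy the
F-rational clause of `FRationalResolution`. Suppose that at every singular point `s` the local ring
`𝒪_{X,s}` is `k`-isomorphic to the local ring of some `A_n = Spec k[y,z,x]/(yz + x^(n+1))` at a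
point where `y, z, x` vanish (the origin), compatibly with the structure maps. Then `X` has a
resolution of singularities. [folklore; Kollár 2007 §2.2, Lipman 1978 §2] -/
theorem hasResolution_fRational_surface_of_An_stalks (p : ℕ) (hp : p.Prime) [CharP k p]
    (X : Scheme.{0}) [IsIntegral X] (f : X ⟶ Spec (.of k)) [LocallyOfFiniteType f]
    [QuasiCompact f]
    (hFR : ∀ x : X, IsDomain (X.presheaf.stalk x) ∧ ∀ d : ℕ, ringKrullDim (X.presheaf.stalk x) = d →
      ∀ s : Fin d → X.presheaf.stalk x, (Ideal.span (Set.range s)).radical.IsMaximal →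
      ∀ y c : X.presheaf.stalk x, c ≠ 0 →
      (∀ e : ℕ, c * y ^ p ^ e ∈ Ideal.span ((fun z : X.presheaf.stalk x => z ^ p ^ e) ''
        (Ideal.span (Set.range s) : Set (X.presheaf.stalk x)))) → y ∈ Ideal.span (Set.range s))
    (hdim : topologicalKrullDim X ≤ 2)
    (hstalk : ∀ s : X, s ∉ Scheme.regularLocus X → ∃ (n : ℕ) (q : Spec (CommRingCat.of (MvPolynomial (Fin 2 ⊕ Fin 1) k ⧸ Ideal.span
      {(MvPolynomial.X (Sum.inl 0) * MvPolynomial.X (Sum.inl 1) +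
        MvPolynomial.rename Sum.inr (MvPolynomial.X 0 ^ (n + 1)) : MvPolynomial (Fin 2 ⊕ Fin 1) k)})))
      (_ : Ideal.Quotient.mk (Ideal.span
      {(MvPolynomial.X (Sum.inl 0) * MvPolynomial.X (Sum.inl 1) +
        MvPolynomial.rename Sum.inr (MvPolynomial.X 0 ^ (n + 1)) : MvPolynomial (Fin 2 ⊕ Fin 1) k)}) (MvPolynomial.X (Sum.inl 0)) ∈ q.asIdeal ∧
        Ideal.Quotient.mk (Ideal.span
      {(MvPolynomial.X (Sum.inl 0) * MvPolynomial.X (Sum.inl 1) +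
        MvPolynomial.rename Sum.inr (MvPolynomial.X 0 ^ (n + 1)) : MvPolynomial (Fin 2 ⊕ Fin 1) k)}) (MvPolynomial.X (Sum.inl 1)) ∈ q.asIdeal ∧
        Ideal.Quotient.mk (Ideal.span
      {(MvPolynomial.X (Sum.inl 0) * MvPolynomial.X (Sum.inl 1) +
        MvPolynomial.rename Sum.inr (MvPolynomial.X 0 ^ (n + 1)) : MvPolynomial (Fin 2 ⊕ Fin 1) k)}) (MvPolynomial.X (Sum.inr 0)) ∈ q.asIdeal)
      (e : (Spec (CommRingCat.of (MvPolynomial (Fin 2 ⊕ Fin 1) k ⧸ Ideal.span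
      {(MvPolynomial.X (Sum.inl 0) * MvPolynomial.X (Sum.inl 1) +
        MvPolynomial.rename Sum.inr (MvPolynomial.X 0 ^ (n + 1)) : MvPolynomial (Fin 2 ⊕ Fin 1) k)}))).presheaf.stalk q ≅ X.presheaf.stalk s),
      Spec.map e.hom ≫ (Spec (CommRingCat.of (MvPolynomial (Fin 2 ⊕ Fin 1) k ⧸ Ideal.span
      {(MvPolynomial.X (Sum.inl 0) * MvPolynomial.X (Sum.inl 1) +
        MvPolynomial.rename Sum.inr (MvPolynomial.X 0 ^ (n + 1)) : MvPolynomial (Fin 2 ⊕ Fin 1) k)}))).fromSpecStalk q ≫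
        Spec.map (CommRingCat.ofHom (algebraMap k (MvPolynomial (Fin 2 ⊕ Fin 1) k ⧸ Ideal.span
      {(MvPolynomial.X (Sum.inl 0) * MvPolynomial.X (Sum.inl 1) +
        MvPolynomial.rename Sum.inr (MvPolynomial.X 0 ^ (n + 1)) : MvPolynomial (Fin 2 ⊕ Fin 1) k)}))) = X.fromSpecStalk s ≫ f) :
    Scheme.HasResolution X := by
  refine hasResolution_fRational_surface_of_An_charts p hp k X f hFR hdim fun s hs => ?_
  obtain ⟨n, q, hq, e, he⟩ := hstalk s hs
  -- `A_n` is an integral `k`-scheme of finite type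
  haveI : IsDomain (CommRingCat.of RA[n]) := An_isDomain k n
  haveI : LocallyOfFiniteType (Spec.map (CommRingCat.ofHom (algebraMap k RA[n]))) :=
    An_locallyOfFiniteType k n
  -- Zariski-local recognition: an `A_n` chart at `s`
  obtain ⟨U, hsU, j, hj, hjs, -⟩ := exists_isOpenImmersion_nhd_of_stalk_iso k X
    (Spec (CommRingCat.of RA[n])) f (Spec.map (CommRingCat.ofHom (algebraMap k RA[n]))) s q e he
  haveI := hj
  -- `n ≥ 1`: otherwise `s` would be a regular point
  have hn : 1 ≤ n := by
    rcases Nat.eq_zero_or_pos n with h0 | hpos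
    · subst h0
      haveI : IsRegularLocalRing ((Spec (CommRingCat.of RA[0])).presheaf.stalk q) :=
        An_zero_isRegular k q
      exact absurd (show IsRegularLocalRing (X.presheaf.stalk s) from
        IsRegularLocalRing.of_ringEquiv e.commRingCatIsoToRingEquiv) hs
    · exact hpos
  -- the regular loci correspond under `j`
  have hReg : IsOpen (Scheme.regularLocus (Spec (CommRingCat.of RA[n]))) :=
    isOpen_regularLocus_of_locallyOfFiniteType_field
      (Spec.map (CommRingCat.ofHom (algebraMap k RA[n])))
  have hD : ((PrimeSpectrum.basicOpen (mkA[n] (MvPolynomial.X (Sum.inl 0))) ⊔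
      PrimeSpectrum.basicOpen (mkA[n] (MvPolynomial.X (Sum.inl 1))) ⊔
      PrimeSpectrum.basicOpen (mkA[n] (MvPolynomial.X (Sum.inr 0)))) : (Spec (CommRingCat.of RA[n])).Opens) =
      ⟨Scheme.regularLocus (Spec (CommRingCat.of RA[n])), hReg⟩ := by
    apply le_antisymm
    · intro r hr
      show r ∈ Scheme.regularLocus (Spec (CommRingCat.of RA[n]))
      rw [An_mem_regularLocus_iff k n hn r]
      rcases hr with (hr | hr) | hr
      · exact Or.inl hr
      · exact Or.inr (Or.inl hr)
      · exact Or.inr (Or.inr hr)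
    · intro r hr
      have hr' : r ∈ Scheme.regularLocus (Spec (CommRingCat.of RA[n])) := hr
      rw [An_mem_regularLocus_iff k n hn r] at hr'
      rcases hr' with hr | hr | hr
      · exact Or.inl (Or.inl hr)
      · exact Or.inl (Or.inr hr)
      · exact Or.inr hr
  have hpre := preimage_regularLocus_of_isOpenImmersion U j
    (isOpen_regularLocus_of_locallyOfFiniteType_field f) hReg
  refine ⟨U, n, j, hsU, ?_, hj, ?_⟩
  · -- no other singular point in `U`: singular points of `U` go to the origin, `j` is injective
    intro t ht htU
    have hjt : j ⟨t, htU⟩ ∉ Scheme.regularLocus (Spec (CommRingCat.of RA[n])) := by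
      intro hreg
      have hmem : (⟨t, htU⟩ : U) ∈ j ⁻¹ᵁ ⟨Scheme.regularLocus (Spec (CommRingCat.of RA[n])), hReg⟩ :=
        hreg
      rw [hpre] at hmem
      exact ht hmem
    have hjs' : j ⟨s, hsU⟩ ∉ Scheme.regularLocus (Spec (CommRingCat.of RA[n])) := by
      intro hreg
      have hmem : (⟨s, hsU⟩ : U) ∈ j ⁻¹ᵁ ⟨Scheme.regularLocus (Spec (CommRingCat.of RA[n])), hReg⟩ :=
        hreg
      rw [hpre] at hmem
      exact hs hmem
    rw [An_mem_regularLocus_iff k n hn] at hjt hjs'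
    push_cast [not_or, not_not] at hjt hjs'
    have heq : j ⟨t, htU⟩ = j ⟨s, hsU⟩ := An_point_eq_of_X_mem k n _ _ hjt hjs'
    have hinj := hj.base_open.injective heq
    exact congrArg Subtype.val hinj
  · rw [hD, hpre]

end Summit.ResolutionOfSingularities.ResolutionOfSingularities.Theorems.FRationalResolution

end
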